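import Summits.CriticalPhenomena.PercolationContinuityZ3.Cruxes.PinholeClosing.SketchIdeator2
import Summits.CriticalPhenomena.PercolationContinuityZ3.Theorems.PinholeClosing.Negative.PinholeClosingResistance
import Literature.Probability.Percolation.SiteConnectionTools

/-!
# Triage scratch (crux-triage r1-1, stmt-CriticalPhenomena-5249): `FlatLandscapeExclusion 2` is false AS TYPED

Card `budget-halving`'s deterministic heart quantifies over ALL `ω : Set (Sym2 (Site 3))`.  Witness (n = 4, l = 16):
the translation-invariant "jump-star" configuration `star 256 = {s(a, a + 256 e₀) : a ∈ ℤ³}`.  No jump fits inside a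
cap window `x + box 64` (width 129 < 256), so every cap holds with budget 0 ≤ 2; but from every `y + box 2` the two
jumps `s(y, y ± 256 e₀)` are distinct one-edge crossings of `y + A(2, 256)` inside `y + box 256`, so budget ≤ 1 fails
at every `y` — no floor anywhere.  Repair: prefix `ω ⊆ (zdGraph 3).edgeSet →` (true `P_p`-a.s.).
All lemmas are kept SYMBOLIC in the radii (closed `box 3 256` terms must never be evaluated by the unifier).
-/

open Literature.Probability.Percolation Literature.Probability.LatticeModels
open Summit.CriticalPhenomena.PercolationContinuityZ3.Cruxes.PinholeClosing.TransitDoubling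
open Summit.CriticalPhenomena.PercolationContinuityZ3.Theorems.PinholeClosing.Negative

namespace TriageR1K1FLE

/-- The lattice point `(i, 0, 0)`. -/
def pt (i : ℕ) : Site 3 := Pi.single 0 (i : ℤ)

@[simp] theorem pt_apply_zero (i : ℕ) : pt i 0 = i := by simp [pt]

theorem pt_apply_ne {j : Fin 3} (hj : j ≠ 0) (i : ℕ) : pt i j = 0 := by simp [pt, hj]

theorem pt_mem_box {i m : ℕ} (h : i ≤ m) : pt i ∈ box 3 m := by
  rw [mem_box]
  intro j
  by_cases hj : j = 0
  · subst hj; simp only [pt_apply_zero]; omega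
  · simp only [pt_apply_ne hj]; omega

theorem neg_pt_mem_box {i m : ℕ} (h : i ≤ m) : -pt i ∈ box 3 m := by
  rw [mem_box]
  intro j
  by_cases hj : j = 0
  · subst hj; simp only [Pi.neg_apply, pt_apply_zero]; omega
  · simp only [Pi.neg_apply, pt_apply_ne hj]; omega

theorem le_of_pt_mem_box {i n : ℕ} (h : pt i ∈ box 3 n) : i ≤ n := by
  rw [mem_box] at h
  have := (h 0).2
  simp only [pt_apply_zero] at this
  exact_mod_cast this

theorem pt_succ_eq (i : ℕ) : pt (i + 1) = pt i + Pi.single 0 1 := by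
  simp [pt, Nat.cast_succ, Pi.single_add]

theorem pt_mem_innerBoundary (m : ℕ) : pt m ∈ innerBoundary (zdGraph 3) (box 3 m) := by
  rw [mem_innerBoundary_iff]
  refine ⟨pt_mem_box le_rfl, pt (m + 1), fun h => ?_, ?_⟩
  · have := le_of_pt_mem_box h; omega
  · rw [zdGraph_adj_iff]; exact ⟨0, Or.inl (pt_succ_eq m)⟩

theorem neg_pt_mem_innerBoundary (m : ℕ) : -pt m ∈ innerBoundary (zdGraph 3) (box 3 m) := by
  rw [mem_innerBoundary_iff]
  refine ⟨neg_pt_mem_box le_rfl, -pt (m + 1), fun h => ?_, ?_⟩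
  · rw [mem_box] at h
    have := (h 0).1
    simp only [Pi.neg_apply, pt_apply_zero] at this
    omega
  · rw [zdGraph_adj_iff]
    refine ⟨0, Or.inr ?_⟩
    rw [pt_succ_eq, neg_add, neg_add_cancel_right]

/-- The translation-invariant jump-star configuration with jump `N e₀`. -/
def star (N : ℕ) : BondConfig (Site 3) := {e | ∃ a : Site 3, e = s(a, a + pt N)}

theorem mk_mem_star_iff (N : ℕ) (p q : Site 3) : s(p, q) ∈ star N ↔ q = p + pt N ∨ p = q + pt N := by
  constructor
  · rintro ⟨a, ha⟩
    rcases Sym2.eq_iff.1 ha with ⟨rfl, rfl⟩ | ⟨rfl, rfl⟩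
    · exact Or.inl rfl
    · exact Or.inr rfl
  · rintro (h | h)
    · exact ⟨p, by rw [h]⟩
    · exact ⟨q, by rw [h, Sym2.eq_swap]⟩

/-- `star N` is translation invariant. -/
theorem relabel_shift_star (N : ℕ) (y : Site 3) :
    BondConfig.relabel (sym2Equiv (Site.shift y)) (star N) = star N := by
  ext e
  induction e using Sym2.ind with
  | h p q =>
    rw [BondConfig.mem_relabel_iff, sym2Equiv_symm, sym2Equiv_mk, Site.shift_symm_apply,
      Site.shift_symm_apply, mk_mem_star_iff, mk_mem_star_iff]
    rw [show p - y + pt N = p + pt N - y from (add_sub_right_comm p (pt N) y).symm,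
      show q - y + pt N = q + pt N - y from (add_sub_right_comm q (pt N) y).symm,
      sub_left_inj, sub_left_inj]

/-- No jump fits inside `box 3 L` when `2L < N`. -/
theorem no_mk_mem_star {N L : ℕ} (hL : 2 * L < N) {T : Set (Sym2 (Site 3))} {p q : Site 3}
    (hp : p ∈ box 3 L) (hq : q ∈ box 3 L) (h : s(p, q) ∈ star N \ T) : False := by
  obtain ⟨h, -⟩ := h
  rw [mk_mem_star_iff] at h
  rw [mem_box] at hp hq
  have hp0 := hp 0
  have hq0 := hq 0
  rcases h with h | h
  · have h0 : q 0 = p 0 + pt N 0 := by rw [h]; rfl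
    simp only [pt_apply_zero] at h0
    omega
  · have h0 : p 0 = q 0 + pt N 0 := by rw [h]; rfl
    simp only [pt_apply_zero] at h0
    omega

/-- CAPS: the centred window `A(n, L)` (`n < L`, `2L < N`) has budget 0 (hence `≤ K`) in `star N`. -/
theorem star_mem_budget {N n L : ℕ} (hnL : n < L) (hL : 2 * L < N) (K : ℕ) : star N ∈ Budget n L K := by
  refine ⟨∅, by simp, ?_⟩
  rintro ⟨a, ha, b, hb, haS, hbS, hr⟩
  obtain ⟨w⟩ := hr
  cases w with
  | nil => exact absurd ha (notMem_box_of_mem_innerBoundary hnL hb)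
  | cons hadj p =>
    rename_i c
    simp only [SimpleGraph.induce_adj, openGraph_adj] at hadj
    exact no_mk_mem_star hL (Finset.mem_coe.1 haS) (Finset.mem_coe.1 c.2) hadj.1

theorem zero_mem_box (m : ℕ) : (0 : Site 3) ∈ box 3 m := by simp [mem_box]

/-- A single open pair from `0 ∈ box m` to `w ∈ ∂ⁱⁿ box N` is a crossing of `A(m, N)`. -/
theorem cross_of_mem {ω : BondConfig (Site 3)} {m N : ℕ} {w : Site 3}
    (hw : w ∈ innerBoundary (zdGraph 3) (box 3 N)) (hne : (0 : Site 3) ≠ w) (h : s(0, w) ∈ ω) :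
    Cross m N ω := by
  have hwb : w ∈ box 3 N := (mem_innerBoundary_iff.1 hw).1
  refine ⟨0, zero_mem_box m, w, hw, Finset.mem_coe.2 (zero_mem_box N), Finset.mem_coe.2 hwb, ?_⟩
  refine SimpleGraph.Adj.reachable ?_
  simp only [SimpleGraph.induce_adj, openGraph_adj]
  exact ⟨h, hne⟩

theorem zero_ne_pt {N : ℕ} (hN : 1 ≤ N) : (0 : Site 3) ≠ pt N := by
  intro h; have := congrArg (fun x : Site 3 => x 0) h; simp at this; omega

theorem zero_ne_neg_pt {N : ℕ} (hN : 1 ≤ N) : (0 : Site 3) ≠ -pt N := by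
  intro h; have := congrArg (fun x : Site 3 => x 0) h; simp at this; omega

theorem pt_ne_neg_pt {N : ℕ} (hN : 1 ≤ N) : pt N ≠ -pt N := by
  intro h; have := congrArg (fun x : Site 3 => x 0) h; simp at this; omega

/-- FLOORS hold everywhere: the centred `A(m, N)` is NOT budget-1 blocked in `star N` (two distinct one-edge
crossings `s(0, ±N e₀)`). -/
theorem star_notMem_budget {N : ℕ} (hN : 1 ≤ N) (m : ℕ) : star N ∉ Budget m N 1 := by
  rintro ⟨S, hS, hnot⟩
  apply hnot
  have h1 : s((0 : Site 3), pt N) ∈ star N := (mk_mem_star_iff N 0 (pt N)).2 (Or.inl (by simp))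
  have h2 : s((0 : Site 3), -pt N) ∈ star N := (mk_mem_star_iff N 0 (-pt N)).2 (Or.inr (by simp))
  have hne : s((0 : Site 3), pt N) ≠ s(0, -pt N) := by
    intro h
    rcases Sym2.eq_iff.1 h with ⟨-, h⟩ | ⟨h, -⟩
    · exact pt_ne_neg_pt hN h
    · exact zero_ne_neg_pt hN h
  by_cases hv : s((0 : Site 3), pt N) ∈ S
  · have hv' : s((0 : Site 3), -pt N) ∉ S := by
      intro hv'
      have hsub : ({s((0 : Site 3), pt N), s(0, -pt N)} : Finset _) ⊆ S := by
        intro e he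
        simp only [Finset.mem_insert, Finset.mem_singleton] at he
        rcases he with rfl | rfl <;> assumption
      have := Finset.card_le_card hsub
      rw [Finset.card_pair hne] at this
      omega
    exact cross_of_mem (neg_pt_mem_innerBoundary N) (zero_ne_neg_pt hN) ⟨h2, fun h => hv' h⟩
  · exact cross_of_mem (pt_mem_innerBoundary N) (zero_ne_pt hN) ⟨h1, fun h => hv h⟩

/-- **`FlatLandscapeExclusion 2` (card budget-halving, `SketchIdeator2.lean`) is false as typed.** -/
theorem not_flatLandscapeExclusion_two : ¬ FlatLandscapeExclusion 2 := by
  intro h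
  have hcaps : ∀ x : Site 3, (∀ i, (x i).natAbs ≤ 3 * 16 * 4 ∧ ((4 / 4 : ℕ) : ℤ) ∣ x i) →
      star (4 * 16 * 4) ∈ BudgetAt x 4 (16 * 4) 2 := by
    intro x _
    show BondConfig.relabel (sym2Equiv (Site.shift x)) (star (4 * 16 * 4)) ∈ Budget 4 (16 * 4) 2
    rw [relabel_shift_star]
    exact star_mem_budget (by norm_num) (by norm_num) 2
  obtain ⟨y, -, hy⟩ := h 4 16 le_rfl le_rfl (star (4 * 16 * 4)) hcaps
  have hy' : BondConfig.relabel (sym2Equiv (Site.shift y)) (star (4 * 16 * 4)) ∈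
      Budget ((4 + 1) / 2) (4 * 16 * 4) (2 - 1) := hy
  rw [relabel_shift_star] at hy'
  exact star_notMem_budget (N := 4 * 16 * 4) (by norm_num) ((4 + 1) / 2) hy'

end TriageR1K1FLE
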